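import Mathlib
import Literature.Barriers.MatrixMultiplication.NormalizerBarrier
import Literature.RepresentationTheory.FiniteGroups.IrreducibleCharacters
import Literature.RepresentationTheory.FiniteGroups.InducedClassFunction
import Summits.MatrixMultiplication.MatrixMultiplication.Theorems.LieRankDesigns.Negative.Basics
import Summits.MatrixMultiplication.MatrixMultiplication.Theorems.SubgroupIdentityDesigns.Negative.SteinbergTower
import Summits.MatrixMultiplication.MatrixMultiplication.Theorems.SubgroupIdentityDesigns.Negative.HookCharacter
import Summits.MatrixMultiplication.MatrixMultiplication.Theorems.SubgroupIdentityDesigns.Negative.BlockSliceMackey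
import Summits.MatrixMultiplication.MatrixMultiplication.Theorems.SubgroupIdentityDesigns.Negative.ParabolicMackey

/-!
# Block-slice no-go for ALL primes `p`, all `k ≥ 1` and all `l ≥ 3` — unconditional

Supports stmt-MatrixMultiplication-14079 (crux `SubgroupIdentityDesigns`, route `LevelGradedCohnUmans`;
BLOCK-SLICES §2).  VALUE = theorem (a no-go for one family of candidate witnesses), NOT summit
progress: it says nothing about witnesses whose products avoid every translate of a block slice.

`BlockSliceMackey.no_translate_witness` was conditional on the maximal-parabolic Mackey formula
`SteinbergTower.MackeyFormula (ZMod p) N'`; `ParabolicMackey.mackeyFormula` now proves that formula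
for every finite field, so the hypothesis is discharged:

* `isIrrChar_hook` — the hook unipotent character `χ^{(l,1^k)}` of `GL_{k+l}(𝔽_p)` is irreducible
  for every prime `p` and every `l ≥ 1`;
* **`no_translate_witness`** / `no_slice_witness` / `no_slice_witness'` — for `k ≥ 1`, `l ≥ 3`,
  EVERY prime `p`, every `ε > 0` and every subgroup-TPP triple `H₁, H₂, H₃ ≤ GL_{k+l}(𝔽_p)` whose
  products `a b c` lie in a translate `x S_{k+l,k} y` of the block slice
  `S_{k+l,k} = {g : lower-right l × l block of g is 1}`, the budget inequality of the crux
  `Σ_{ψ irr, level ≤ k} ψ(1)^{2+ε} < (|H₁||H₂||H₃|)^{(2+ε)/3}` FAILS.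

This closes the residual corner `k ≥ 2, p ≤ k + 1, 3 ≤ l < 3 + 6⌈log₂(k+1)⌉` left open by
`BlockSliceSummary.no_translate_witness` (in particular `p = 2`, where no non-trivial multiplicative
character exists).
-/

set_option linter.dupNamespace false

noncomputable section

open scoped BigOperators Matrix Classical
open Literature.Barriers.MatrixMultiplication (SubgroupTPP)
open Literature.RepresentationTheory.FiniteGroups
open Summit.MatrixMultiplication.MatrixMultiplication.Theorems.LieRankDesigns.Negative

namespace Summit.MatrixMultiplication.MatrixMultiplication.Theorems.SubgroupIdentityDesigns.Negative

namespace BlockSliceFinal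

open SteinbergTower (MackeyFormula)
open HookCharacter (hook)
open ParabolicMackey (mackeyFormula)

variable {p : ℕ} [hp : Fact p.Prime] {k l : ℕ}

/-- The Mackey hypothesis of `BlockSliceMackey`, discharged. -/
theorem mackey_all (m : ℕ) : ∀ N', N' ≤ m → MackeyFormula (ZMod p) N' :=
  fun N' _ => mackeyFormula N'

/-- **The hook unipotent character `χ^{(l,1^k)}` of `GL_{k+l}(𝔽_p)` is irreducible** (every prime `p`,
every `l ≥ 1`). -/
theorem isIrrChar_hook (hl : 1 ≤ l) : IsIrrChar (GLm p (k + l)) (hook (p := p) k l hl) :=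
  HookCharacter.isIrrChar_hook (mackey_all (k + l)) hl

/-- Hence `χ^{(l,1^k)} ∈ Irr(GL_{k+l}(𝔽_p)) ∩ F_k` (level `≤ k`), unconditionally. -/
theorem hook_mem_irrChars_inter_levelSet (hl : 1 ≤ l) :
    hook (p := p) k l hl ∈ irrChars (GLm p (k + l)) ∩ levelSet p (k + l) k :=
  HookCharacter.hook_mem_irrChars_inter_levelSet (mackey_all (k + l)) hl

/-- **Block-slice no-go, unconditional**: for `k ≥ 1`, `l ≥ 3`, every prime `p` and every `ε > 0`,
no subgroup-TPP triple of `GL_{k+l}(𝔽_p)` with products in a translate `x S_{k+l,k} y` of the block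
slice satisfies the budget inequality of the crux `SubgroupIdentityDesigns`. -/
theorem no_translate_witness (hk : 1 ≤ k) (hl : 3 ≤ l)
    {H₁ H₂ H₃ : Subgroup (GLm p (k + l))} (htpp : SubgroupTPP H₁ H₂ H₃) (x y : GLm p (k + l))
    (hS : ∀ a ∈ H₁, ∀ b ∈ H₂, ∀ c ∈ H₃, ∀ i j : Fin l,
      ((x⁻¹ * (a * b * c) * y⁻¹ : GLm p (k + l)) : Mat p (k + l)) (Fin.natAdd k i)
          (Fin.natAdd k j) = (1 : Matrix (Fin l) (Fin l) (ZMod p)) i j)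
    {ε : ℝ} (hε : 0 < ε) :
    ¬ ((∑ᶠ ψ ∈ irrChars (GLm p (k + l)) ∩ levelSet p (k + l) k, (ψ 1).re ^ (2 + ε)) <
        ((Nat.card H₁ * Nat.card H₂ * Nat.card H₃ : ℕ) : ℝ) ^ ((2 + ε) / 3)) :=
  BlockSliceMackey.no_translate_witness (mackey_all (k + l)) hk hl htpp x y hS hε

/-- The block slice itself (`x = y = 1`). -/
theorem no_slice_witness (hk : 1 ≤ k) (hl : 3 ≤ l)
    {H₁ H₂ H₃ : Subgroup (GLm p (k + l))} (htpp : SubgroupTPP H₁ H₂ H₃)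
    (hS : ∀ a ∈ H₁, ∀ b ∈ H₂, ∀ c ∈ H₃, ∀ i j : Fin l,
      ((a * b * c : GLm p (k + l)) : Mat p (k + l)) (Fin.natAdd k i) (Fin.natAdd k j) =
        (1 : Matrix (Fin l) (Fin l) (ZMod p)) i j)
    {ε : ℝ} (hε : 0 < ε) :
    ¬ ((∑ᶠ ψ ∈ irrChars (GLm p (k + l)) ∩ levelSet p (k + l) k, (ψ 1).re ^ (2 + ε)) <
        ((Nat.card H₁ * Nat.card H₂ * Nat.card H₃ : ℕ) : ℝ) ^ ((2 + ε) / 3)) :=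
  BlockSliceMackey.no_slice_witness (mackey_all (k + l)) hk hl htpp hS hε

/-- `m`-form: for every `m ≥ k + 3` the block slice `S_{m,k} ⊆ GL_m(𝔽_p)` carries no witness. -/
theorem no_slice_witness' {m : ℕ} (hk : 1 ≤ k) (hm : k + 3 ≤ m) :
    ∃ l, m = k + l ∧ ∀ {H₁ H₂ H₃ : Subgroup (GLm p (k + l))}, SubgroupTPP H₁ H₂ H₃ →
      (∀ a ∈ H₁, ∀ b ∈ H₂, ∀ c ∈ H₃, ∀ i j : Fin l,
        ((a * b * c : GLm p (k + l)) : Mat p (k + l)) (Fin.natAdd k i) (Fin.natAdd k j) =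
          (1 : Matrix (Fin l) (Fin l) (ZMod p)) i j) →
      ∀ {ε : ℝ}, 0 < ε →
        ¬ ((∑ᶠ ψ ∈ irrChars (GLm p (k + l)) ∩ levelSet p (k + l) k, (ψ 1).re ^ (2 + ε)) <
            ((Nat.card H₁ * Nat.card H₂ * Nat.card H₃ : ℕ) : ℝ) ^ ((2 + ε) / 3)) :=
  BlockSliceMackey.no_slice_witness' (mackey_all m) hk hm

end BlockSliceFinal

end Summit.MatrixMultiplication.MatrixMultiplication.Theorems.SubgroupIdentityDesigns.Negative

end
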